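import Literature.NumberTheory.LFunctions.OdlyzkoZeroSumInequality
import Literature.NumberTheory.LFunctions.DedekindZetaDiscriminantBound
import HarnessLib

/-!
# Odlyzko's discriminant bound by the differencing method:
# `log|d_K| ≥ r₁(log π − ψ(σ/2) + g_ℝ) + 2r₂(log 2π − ψ(σ) + g_ℂ) − 2/σ − 2/(σ−1) − c`

Topic `Summits/QuantumAdvantage/QuantumAdvantage/Theorems`, helper file for the crux
`DegreeOnePrimesEscape` (stmt-QuantumAdvantage-11543, closed) of route `LinnikCubicClassGroups`;
cell B2b-1 (linnik-cubic), PART A. HONEST FRAMING: the value of this file is a THEOREM (explicit,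
kernel-checked discriminant bounds) — NOT summit progress.

The tree's Stark bound (`Literature.NumberTheory.LFunctions.NumberField.log_absdiscr_ge_stark`,
[Bordelles2020ArithmeticTales, Prop. 7.32]) discards the zero sum `Σ_ρ 2 Re 1/(σ−ρ) ≥ 0` in Stark's
identity for `ξ_K'/ξ_K(σ)`; its asymptotic constants are `(4πe^γ, 2πe^γ) ≈ (22.38, 11.19)`.
Odlyzko [Odlyzko1976, Odlyzko1977] bounded the zero sum from below by comparing Stark's identity
at `σ` with its derivatives at auxiliary points `σ_i > 1` (where `½ log|d_K|` drops out), via a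
pointwise inequality between the kernels checked on the boundary of the critical strip.  With the
tree's abstract form of that method (`Odlyzko1977.finset_sum_mul_re_logDeriv_nonneg_of_boundary`,
derivatives replaced by a difference) and ONE difference — coefficients `(1, 25/2, −25/2)` at the
points `(σ, 31/25, 32/25)` — we obtain, for every number field `K` of signature `(r₁, r₂)` and every
`1 < σ ≤ 21/20`:

  `log|d_K| ≥ r₁(log π − ψ(σ/2) + g_ℝ) + 2r₂(log 2π − ψ(σ) + g_ℂ) − 2/σ − 2/(σ−1) − 323125/20832`
  `            + 2Λ_K(σ) + 25(Λ_K(31/25) − Λ_K(32/25))`,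

where `g_ℝ = (25/2)(ψ(16/25) − ψ(31/50)) ≈ 0.8395`, `g_ℂ = (25/2)(ψ(32/25) − ψ(31/25)) ≈ 0.5922`,
`Λ_K(τ) = Σ_𝔞 Λ(𝔞)N𝔞^{−τ} ≥ 0` is decreasing (so both prime terms may be dropped), and
`323125/20832 ≈ 15.51`.  The gains `g_ℝ, g_ℂ` raise the asymptotic root-discriminant constants from
`(22.38, 11.19)` to `(4πe^{γ+g_ℝ}, 2πe^{γ+g_ℂ}) ≈ (51.8, 20.2)` (numerics in the companion file
`…OdlyzkoDiscriminantBoundNumeric`); Odlyzko's optimised twelve-term version gives `(60.1, 22.2)`.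

* `kernel_re_of_boundary` — on the lines `Re z ∈ {0, 1}`:
  `Re(1/(τ−z) + 1/(τ−1+z)) = (τ−1)/((τ−1)²+y²) + τ/(τ²+y²)` (`y = Im z`);
* `boundary_combination_nonneg` — the pointwise inequality for `(1, 25/2, −25/2; σ, 31/25, 32/25)`,
  `1 < σ ≤ 21/20`: it reduces to the cubic `7166W³ + 3244372W² − 1278114106W + 126973623168 ≥ 0`
  (`W = 625y² ≥ 0`; the quadratic part has negative discriminant);
* `re_LSeries_vonMangoldtNorm_antitone` — `τ ↦ Λ_K(τ)` is decreasing on `(1, ∞)`;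
* `xi_combination_nonneg` — `Re ξ_K'/ξ_K(σ) + (25/2)Re ξ_K'/ξ_K(31/25) − (25/2)Re ξ_K'/ξ_K(32/25) ≥ 0`;
* `log_absdiscr_ge_odlyzko_primes`, `log_absdiscr_ge_odlyzko` — the displayed bound with / without
  the prime terms.

## References

* A. M. Odlyzko, *Lower bounds for discriminants of number fields. II*, Tôhoku Math. J. 29 (1977)
  209–216. [Odlyzko1977]
* A. M. Odlyzko, *Lower bounds for discriminants of number fields*, Acta Arith. 29 (1976) 275–297.
  [Odlyzko1976]
* O. Bordellès, *Arithmetic Tales. Advanced Edition* (2020), Prop. 7.32. [Bordelles2020ArithmeticTales]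
-/

noncomputable section

open scoped NumberField
open Complex Filter Topology Set NumberField NumberField.InfinitePlace

namespace Summit.QuantumAdvantage.QuantumAdvantage.Theorems.DegreeOnePrimesEscape

namespace OdlyzkoBound

open Literature.NumberTheory.LFunctions Literature.NumberTheory.LFunctions.NumberField

/-! ### The kernel on the boundary of the critical strip -/

/-- `Re 1/(τ − z) = (τ − Re z)/((τ − Re z)² + (Im z)²)`. [folklore] -/
private theorem re_one_div_sub (τ : ℝ) (z : ℂ) :
    (1 / ((τ : ℂ) - z)).re = (τ - z.re) / ((τ - z.re) ^ 2 + z.im ^ 2) := by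
  rw [one_div, Complex.inv_re, Complex.normSq_apply]
  simp only [sub_re, ofReal_re, sub_im, ofReal_im, zero_sub]
  ring

/-- `Re 1/(τ − 1 + z) = (τ − 1 + Re z)/((τ − 1 + Re z)² + (Im z)²)`. [folklore] -/
private theorem re_one_div_sub_one_add (τ : ℝ) (z : ℂ) :
    (1 / ((τ : ℂ) - 1 + z)).re = (τ - 1 + z.re) / ((τ - 1 + z.re) ^ 2 + z.im ^ 2) := by
  rw [one_div, Complex.inv_re, Complex.normSq_apply]
  simp only [add_re, sub_re, ofReal_re, one_re, add_im, sub_im, ofReal_im, one_im, sub_zero,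
    zero_add]
  ring

/-- **The kernel on the boundary lines**: for `Re z ∈ {0, 1}` and real `τ`,
`Re(1/(τ − z) + 1/(τ − 1 + z)) = (τ−1)/((τ−1)² + y²) + τ/(τ² + y²)` with `y = Im z`
(Odlyzko's `E(σ, 1 + iy)`). [cite: Odlyzko1977, p. 214] -/
theorem kernel_re_of_boundary (τ : ℝ) {z : ℂ} (hz : z.re = 0 ∨ z.re = 1) :
    (1 / ((τ : ℂ) - z) + 1 / ((τ : ℂ) - 1 + z)).re =
      (τ - 1) / ((τ - 1) ^ 2 + z.im ^ 2) + τ / (τ ^ 2 + z.im ^ 2) := by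
  rw [add_re, re_one_div_sub, re_one_div_sub_one_add]
  rcases hz with h | h <;> rw [h] <;> ring

/-! ### The pointwise inequality for the parameters `(1, 25/2, −25/2; σ, 31/25, 32/25)` -/

/-- The cubic `7166W³ + 3244372W² − 1278114106W + 126973623168` is non-negative for `W ≥ 0`
(its quadratic part has negative discriminant: `4·3244372·126973623168 > 1278114106²`). [folklore] -/
private theorem cubic_nonneg {W : ℝ} (hW : 0 ≤ W) :
    0 ≤ 7166 * W ^ 3 + 3244372 * W ^ 2 - 1278114106 * W + 126973623168 := by
  nlinarith [sq_nonneg (6488744 * W - 1278114106), pow_nonneg hW 3]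

/-- The one-difference comparison function
`f(Y) = 1/(21/20 + Y) + (25/2)(e(31/25, Y) − e(32/25, Y))`,
`e(τ, Y) = (τ−1)/((τ−1)² + Y) + τ/(τ² + Y)`, is non-negative for `Y ≥ 0`. [folklore] -/
private theorem comparison_nonneg {Y : ℝ} (hY : 0 ≤ Y) :
    0 ≤ 1 / (21 / 20 + Y) +
      (25 / 2) * ((6 / 25) / ((6 / 25) ^ 2 + Y) + (31 / 25) / ((31 / 25) ^ 2 + Y)) -
      (25 / 2) * ((7 / 25) / ((7 / 25) ^ 2 + Y) + (32 / 25) / ((32 / 25) ^ 2 + Y)) := by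
  have h1 : (0 : ℝ) < 21 / 20 + Y := by positivity
  have h2 : (0 : ℝ) < (6 / 25) ^ 2 + Y := by positivity
  have h3 : (0 : ℝ) < (31 / 25) ^ 2 + Y := by positivity
  have h4 : (0 : ℝ) < (7 / 25) ^ 2 + Y := by positivity
  have h5 : (0 : ℝ) < (32 / 25) ^ 2 + Y := by positivity
  set W : ℝ := 625 * Y with hW
  have hW0 : 0 ≤ W := by positivity
  have hcubic := cubic_nonneg hW0
  have hD : (0 : ℝ) < (2625 + 4 * W) * (36 + W) * (49 + W) * (961 + W) * (1024 + W) := by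
    positivity
  have key : 1 / (21 / 20 + Y) +
      (25 / 2) * ((6 / 25) / ((6 / 25) ^ 2 + Y) + (31 / 25) / ((31 / 25) ^ 2 + Y)) -
      (25 / 2) * ((7 / 25) / ((7 / 25) ^ 2 + Y) + (32 / 25) / ((32 / 25) ^ 2 + Y)) =
      (625 / 2) * (7166 * W ^ 3 + 3244372 * W ^ 2 - 1278114106 * W + 126973623168) /
        ((2625 + 4 * W) * (36 + W) * (49 + W) * (961 + W) * (1024 + W)) := by
    rw [eq_div_iff hD.ne']
    field_simp
    rw [hW]
    ring
  rw [key]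
  positivity

/-- **The pointwise inequality on the boundary** for Odlyzko's method with one difference: for
`1 < σ ≤ 21/20` and `Y ≥ 0`,
`e(σ, Y) + (25/2)e(31/25, Y) − (25/2)e(32/25, Y) ≥ 0`, `e(τ, Y) = (τ−1)/((τ−1)² + Y) + τ/(τ² + Y)`
(the term `(σ−1)/((σ−1)²+Y) ≥ 0` is dropped and `σ/(σ²+Y) ≥ 1/(21/20+Y)`).
[cite: Odlyzko1977, eq. (13)] -/
theorem boundary_combination_nonneg {σ Y : ℝ} (hσ : 1 < σ) (hσ' : σ ≤ 21 / 20) (hY : 0 ≤ Y) :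
    0 ≤ 1 * ((σ - 1) / ((σ - 1) ^ 2 + Y) + σ / (σ ^ 2 + Y)) +
      (25 / 2) * ((31 / 25 - 1) / ((31 / 25 - 1) ^ 2 + Y) + (31 / 25) / ((31 / 25) ^ 2 + Y)) +
      (-(25 / 2)) * ((32 / 25 - 1) / ((32 / 25 - 1) ^ 2 + Y) + (32 / 25) / ((32 / 25) ^ 2 + Y)) := by
  have hcmp := comparison_nonneg hY
  have hA : 0 ≤ (σ - 1) / ((σ - 1) ^ 2 + Y) := div_nonneg (by linarith) (by positivity)
  have hB : 1 / (21 / 20 + Y) ≤ σ / (σ ^ 2 + Y) := by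
    rw [div_le_div_iff₀ (by positivity) (by positivity)]
    nlinarith
  have e1 : (31 / 25 - 1 : ℝ) = 6 / 25 := by norm_num
  have e2 : (32 / 25 - 1 : ℝ) = 7 / 25 := by norm_num
  rw [e1, e2]
  linarith

/-- The pointwise inequality in the shape of `Odlyzko1977.finset_sum_mul_re_logDeriv_nonneg_of_boundary`
(`ι = Fin 3`, `c = (1, 25/2, −25/2)`, `τ = (σ, 31/25, 32/25)`). [cite: Odlyzko1977, eq. (13)] -/
theorem boundary_sum_nonneg {σ : ℝ} (hσ : 1 < σ) (hσ' : σ ≤ 21 / 20) (z : ℂ)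
    (hz : z.re = 0 ∨ z.re = 1) :
    0 ≤ ∑ i : Fin 3, (![1, 25 / 2, -(25 / 2)] : Fin 3 → ℝ) i *
      (1 / (((![σ, 31 / 25, 32 / 25] : Fin 3 → ℝ) i : ℝ) - z) +
        1 / (((![σ, 31 / 25, 32 / 25] : Fin 3 → ℝ) i : ℂ) - 1 + z)).re := by
  simp only [Fin.sum_univ_three, Matrix.cons_val_zero, Matrix.cons_val_one, Matrix.cons_val_two,
    Matrix.head_cons, Matrix.tail_cons]
  rw [kernel_re_of_boundary σ hz, kernel_re_of_boundary (31 / 25) hz,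
    kernel_re_of_boundary (32 / 25) hz]
  have h := boundary_combination_nonneg hσ hσ' (sq_nonneg z.im)
  linarith

/-! ### The prime sum is decreasing in `σ` -/

variable {K : Type*} [Field K] [NumberField K]

/-- **`τ ↦ Λ_K(τ) = Σ_𝔞 Λ(𝔞)N𝔞^{−τ}` is decreasing on `(1, ∞)`** (termwise: `n^{−τ'} ≤ n^{−τ}`
for `n ≥ 1`, `τ ≤ τ'`, all coefficients `Λ_K(n) ≥ 0`). [folklore] -/
theorem re_LSeries_vonMangoldtNorm_antitone {τ τ' : ℝ} (hτ : 1 < τ) (hττ' : τ ≤ τ') :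
    (LSeries (fun n ↦ (vonMangoldtNorm K n : ℂ)) τ').re ≤
      (LSeries (fun n ↦ (vonMangoldtNorm K n : ℂ)) τ).re := by
  have hs : 1 < (τ : ℂ).re := by simpa using hτ
  have hs' : 1 < (τ' : ℂ).re := by simp; linarith
  have hterm : ∀ (u : ℝ) (n : ℕ), (LSeries.term (fun n ↦ (vonMangoldtNorm K n : ℂ)) u n).re =
      if n = 0 then 0 else vonMangoldtNorm K n / (n : ℝ) ^ u := by
    intro u n
    rcases eq_or_ne n 0 with rfl | hn
    · simp [LSeries.term]
    · rw [LSeries.term_of_ne_zero hn, if_neg hn, show (n : ℂ) = ((n : ℝ) : ℂ) by norm_cast,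
        ← Complex.ofReal_cpow (Nat.cast_nonneg n), ← Complex.ofReal_div, Complex.ofReal_re]
  rw [LSeries, LSeries, Complex.re_tsum (LSeriesSummable_vonMangoldtNorm hs),
    Complex.re_tsum (LSeriesSummable_vonMangoldtNorm hs')]
  refine Summable.tsum_le_tsum (fun n ↦ ?_)
    ((Complex.hasSum_re (LSeriesSummable_vonMangoldtNorm hs').hasSum).summable)
    ((Complex.hasSum_re (LSeriesSummable_vonMangoldtNorm hs).hasSum).summable)
  rw [hterm, hterm]
  split_ifs with hn
  · exact le_rfl
  · have hn1 : (1 : ℝ) ≤ n := by exact_mod_cast Nat.one_le_iff_ne_zero.mpr hn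
    exact div_le_div_of_nonneg_left (vonMangoldtNorm_nonneg n) (by positivity)
      (Real.rpow_le_rpow_of_exponent_le hn1 hττ')

/-! ### The zero-sum inequality for `ξ_K` and the discriminant bound -/

variable (K) in
/-- **The zero sum of `ξ_K` against Odlyzko's one-difference kernel is non-negative**: for
`1 < σ ≤ 21/20` and the tree's entire completion `ξ = ξ_K` (`exists_starkXi`),
`Re ξ'/ξ(σ) + (25/2) Re ξ'/ξ(31/25) − (25/2) Re ξ'/ξ(32/25) ≥ 0`.
[cite: Odlyzko1977, eqs. (11)–(13)] -/
theorem xi_combination_nonneg {ξ : ℂ → ℂ} (hdiff : Differentiable ℂ ξ)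
    (hsymm : ∀ s, ξ (1 - s) = ξ s) {C : ℝ} (hC : ∀ s, ‖ξ s‖ ≤ C * Real.exp (‖s‖ ^ (15 / 8 : ℝ)))
    (hpos : ∀ s : ℂ, 0 < s.re → ξ s = s * dedekindZeta₁ K s * dedekindGammaFactor K s)
    {σ : ℝ} (hσ : 1 < σ) (hσ' : σ ≤ 21 / 20) :
    0 ≤ (logDeriv ξ σ).re + 25 / 2 * (logDeriv ξ (31 / 25 : ℝ)).re -
      25 / 2 * (logDeriv ξ (32 / 25 : ℝ)).re := by
  have hzero : ∀ s, ξ s = 0 → s.re ≤ 1 := fun s hs ↦ (xi_zero hsymm hpos hs).2.1.le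
  have hτ : ∀ i ∈ (Finset.univ : Finset (Fin 3)),
      1 < (![σ, 31 / 25, 32 / 25] : Fin 3 → ℝ) i := by
    intro i _
    fin_cases i
    · simpa using hσ
    · simp only [Fin.mk_one, Matrix.cons_val_one, Matrix.cons_val]; norm_num
    · simp only [Fin.reduceFinMk, Matrix.cons_val_two, Matrix.tail_cons, Matrix.head_cons]
      norm_num
  have h := Odlyzko1977.finset_sum_mul_re_logDeriv_nonneg_of_boundary hdiff hsymm
    (by norm_num : (15 / 8 : ℝ) < 2) (by norm_num) hC hzero Finset.univ
    (![1, 25 / 2, -(25 / 2)] : Fin 3 → ℝ) (![σ, 31 / 25, 32 / 25] : Fin 3 → ℝ) hτ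
    (fun z hz ↦ boundary_sum_nonneg hσ hσ' z hz)
  simp only [Fin.sum_univ_three, Matrix.cons_val_zero, Matrix.cons_val_one, Matrix.cons_val_two,
    Matrix.head_cons, Matrix.tail_cons] at h
  linarith

variable (K) in
/-- **Odlyzko's discriminant bound (one difference), with the prime terms**: for every number field
`K` of signature `(r₁, r₂)` and every `1 < σ ≤ 21/20`,
`log|d_K| ≥ r₁(log π − ψ(σ/2) + (25/2)(ψ(16/25) − ψ(31/50))) + 2r₂(log 2π − ψ(σ) + (25/2)(ψ(32/25) − ψ(31/25)))`
`          − 2/σ − 2/(σ−1) − 323125/20832 + 2Λ_K(σ) + 25(Λ_K(31/25) − Λ_K(32/25))`,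
where `Λ_K(τ) = Σ_𝔞 Λ(𝔞)N𝔞^{−τ}` (Stark's identity at `σ` combined with `25/2` times its difference
between `31/25` and `32/25`, the zero sum bounded below by `xi_combination_nonneg`).
[cite: Odlyzko1977, eq. (12)] -/
theorem log_absdiscr_ge_odlyzko_primes {σ : ℝ} (hσ : 1 < σ) (hσ' : σ ≤ 21 / 20) :
    (nrRealPlaces K : ℝ) * (Real.log Real.pi - (digamma ((σ : ℂ) / 2)).re +
        25 / 2 * ((digamma ((16 / 25 : ℝ) : ℂ)).re - (digamma ((31 / 50 : ℝ) : ℂ)).re)) +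
      2 * (nrComplexPlaces K : ℝ) * (Real.log (2 * Real.pi) - (digamma (σ : ℂ)).re +
        25 / 2 * ((digamma ((32 / 25 : ℝ) : ℂ)).re - (digamma ((31 / 25 : ℝ) : ℂ)).re)) -
      2 / σ - 2 / (σ - 1) - 323125 / 20832 +
      2 * (LSeries (fun n ↦ (vonMangoldtNorm K n : ℂ)) σ).re +
      25 * ((LSeries (fun n ↦ (vonMangoldtNorm K n : ℂ)) (31 / 25 : ℝ)).re -
        (LSeries (fun n ↦ (vonMangoldtNorm K n : ℂ)) (32 / 25 : ℝ)).re) ≤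
      Real.log ((discr K).natAbs : ℝ) := by
  obtain ⟨ξ, hdiff, hsymm, ⟨C, hC⟩, hpos⟩ := exists_starkXi K
  have h := xi_combination_nonneg K hdiff hsymm hC hpos hσ hσ'
  rw [re_logDeriv_xi_eq hpos hσ, re_logDeriv_xi_eq hpos (by norm_num : (1 : ℝ) < 31 / 25),
    re_logDeriv_xi_eq hpos (by norm_num : (1 : ℝ) < 32 / 25)] at h
  have e1 : (((31 / 25 : ℝ) : ℂ) / 2) = ((31 / 50 : ℝ) : ℂ) := by push_cast; ring
  have e2 : (((32 / 25 : ℝ) : ℂ) / 2) = ((16 / 25 : ℝ) : ℂ) := by push_cast; ring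
  rw [e1, e2] at h
  norm_num only at h
  have e3 : (2 : ℝ) / σ = 2 * (1 / σ) := by ring
  have e4 : (2 : ℝ) / (σ - 1) = 2 * (1 / (σ - 1)) := by ring
  rw [e3, e4]
  linarith

variable (K) in
/-- **Odlyzko's discriminant bound (one difference)**: for every number field `K` of signature
`(r₁, r₂)` and every `1 < σ ≤ 21/20`,
`log|d_K| ≥ r₁(log π − ψ(σ/2) + (25/2)(ψ(16/25) − ψ(31/50))) + 2r₂(log 2π − ψ(σ) + (25/2)(ψ(32/25) − ψ(31/25)))`
`          − 2/σ − 2/(σ−1) − 323125/20832`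
— Stark's bound [Bordelles2020ArithmeticTales, Prop. 7.32] improved by the gains
`(25/2)(ψ(16/25) − ψ(31/50)) ≈ 0.8395` per real place and `(25/2)(ψ(32/25) − ψ(31/25)) ≈ 0.5922` per
complex place, at the price of the constant `323125/20832 ≈ 15.51`.
[cite: Odlyzko1977, Theorem 1 (method; one-term instance)] -/
theorem log_absdiscr_ge_odlyzko {σ : ℝ} (hσ : 1 < σ) (hσ' : σ ≤ 21 / 20) :
    (nrRealPlaces K : ℝ) * (Real.log Real.pi - (digamma ((σ : ℂ) / 2)).re +
        25 / 2 * ((digamma ((16 / 25 : ℝ) : ℂ)).re - (digamma ((31 / 50 : ℝ) : ℂ)).re)) +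
      2 * (nrComplexPlaces K : ℝ) * (Real.log (2 * Real.pi) - (digamma (σ : ℂ)).re +
        25 / 2 * ((digamma ((32 / 25 : ℝ) : ℂ)).re - (digamma ((31 / 25 : ℝ) : ℂ)).re)) -
      2 / σ - 2 / (σ - 1) - 323125 / 20832 ≤
      Real.log ((discr K).natAbs : ℝ) := by
  have h := log_absdiscr_ge_odlyzko_primes K hσ hσ'
  have hΛσ := re_LSeries_vonMangoldtNorm_nonneg (K := K) hσ
  have hΛ := re_LSeries_vonMangoldtNorm_antitone (K := K) (τ := 31 / 25) (τ' := 32 / 25)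
    (by norm_num) (by norm_num)
  linarith

end OdlyzkoBound

end Summit.QuantumAdvantage.QuantumAdvantage.Theorems.DegreeOnePrimesEscape
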